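import Summits.ABC.ABC.Theorems.DefiniteXiDefiniteRTControlPrimeOfTakahashi
import Literature.NumberTheory.EllipticCurves.PastenHeightBoundsLemma68LocalProofs
import Literature.NumberTheory.EllipticCurves.RationalIsogenyDegreesProofs
import HarnessLib

/-!
# Stub-ideation k2 · gen 15 — `stub_pastenLemma68` (crux `DefiniteRTControlPrime`, stmt-ABC-11338)

Companion to `STUB-IDEAS-stub_pastenLemma68-2.md` (gen 15).  FAMILY 2 (RESHAPE), typed:

* §0  by-name certificates in TODAY's tree: the crux from Takahashi 2.3 alone (landed, p839521);
      the verbatim stub from Mazur–Kenku / from the radius ITEM stmt-ABC-15193 (its only closers);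
      the stub is Mazur-deep (prime isogeny degrees `≤ 163` at a multiplicative place).
* §1  gen-15 RESHAPE T3 — "discharge the fact per consumer": the THREE other theorems of route
      DefiniteXi that take `(h68 : PastenShimura2024_lemma_6_8)` all apply it to a FREY source with
      `N^ε` slack, so the landed Mazur-free radius `OfTakahashi.freyIsogenyRadiusSubpoly` retires
      `h68` (and `h163`) there too.  Helper-lemma STATEMENTS H5–H7 (Props only — stub-ideation
      types, it does not prove), the `163`-template theorems they re-prove are certified by name in the
      sibling file `StubIdeasK2G15PastenLemma68Templates.lean` (split off because its imports sit
      behind a farm module that was unbuilt at check time).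
No `sorry`.
-/

set_option linter.dupNamespace false

namespace Summit.ABC.ABC.Cruxes.DefiniteRTControlPrime.StubIdeasK2G15

open Literature.NumberTheory.EllipticCurves Literature.NumberTheory.EllipticCurves.ModularForms
open Literature.NumberTheory.Automorphic
open WeierstrassCurve IsDedekindDomain
open scoped Classical

/-! ## §0 · Certificates (the sheet's §0 verdict, kernel-checked against today's tree) -/

/-- The crux from Takahashi 2001 Thm 2.3 (coprime form) ALONE — landed (p839521). The stub is moot
for the crux. -/
example (hT : takahashi2001_thm_2_3_of_coprime) :
    Summit.ABC.ABC.Theses.DefiniteXi.DefiniteRTControlPrime :=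
  Summit.ABC.ABC.Theorems.DefiniteRTControlPrime.definiteRTControlPrime_of_takahashi hT

/-- Closer-in-waiting no. 1: the verbatim stub from the Mazur–Kenku named fact (tree). -/
example (hMK : mazurKenku_exists_cyclic_isogeny) : PastenShimura2024_lemma_6_8 :=
  PastenShimura2024_lemma_6_8_of_mazurKenku' hMK

/-- **H0** — closer-in-waiting no. 2: the verbatim stub from the route's radius ITEM
`MazurKenkuRadius` (stmt-ABC-15193, kind `aside`): cyclic companion of the radius isogeny
(`Isogeny.exists_isCyclic_degree_dvd`) + the Mazur-free cyclic transport
`exists_ordMinimalDiscriminant_mul_eq_mul_of_isCyclic` (`a·b ∣ deg ≤ 163`).  (= k2-g14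
`stub_of_radiusItem`, re-checked.) -/
theorem stub_of_radiusItem (hR : Summit.ABC.ABC.Theses.DefiniteXi.MazurKenkuRadius) :
    PastenShimura2024_lemma_6_8 := by
  intro W W' _ _ hiso v hv
  have hv' : W'.HasMultiplicativeReductionAt v := hasMultiplicativeReductionAt_of_isIsogenous hiso v hv
  obtain ⟨φ, hφ⟩ := hR W W' hiso
  obtain ⟨ψ, hψ, hdvd⟩ := φ.exists_isCyclic_degree_dvd
  have hψB : ψ.degree ≤ 163 := (Nat.le_of_dvd φ.degree_pos hdvd).trans hφ
  obtain ⟨a, b, ha, hb, hab, h⟩ :=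
    exists_ordMinimalDiscriminant_mul_eq_mul_of_isCyclic ψ.degree ψ hψ rfl v hv hv'
  have habn : a * b ≤ ψ.degree := Nat.le_of_dvd ψ.degree_pos hab
  refine ⟨a, b, ha, ?_, hb, ?_, h⟩
  · have : a ≤ a * b := Nat.le_mul_of_pos_right a hb
    omega
  · have : b ≤ a * b := Nat.le_mul_of_pos_left b ha
    omega

/-- The stub is Mazur-deep AS TYPED: it forbids prime isogeny degrees `> 163` at a multiplicative
place (Mazur 1978 Thm 1 / Cor 4.4 at non-integral `j`) — tree theorem, so no Mazur-free proof of
the verbatim stub exists. -/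
example (h68 : PastenShimura2024_lemma_6_8) {W W' : WeierstrassCurve ℚ} [W.IsElliptic]
    [W'.IsElliptic] (φ : Isogeny W W') {ℓ : ℕ} (hℓ : ℓ.Prime) (hdeg : φ.degree = ℓ)
    (v : HeightOneSpectrum ℤ) (hv : W.HasMultiplicativeReductionAt v) : ℓ ≤ 163 :=
  prime_degree_le_163_of_PastenShimura2024_lemma_6_8 h68 φ hℓ hdeg v hv

/-- The landed Mazur-free replacement of the stub's RÔLE: sub-polynomial isogeny radius of a Frey
class (unconditional) and the one-isogeny valuation transport. -/
example : Summit.ABC.ABC.Theorems.DefiniteRTControlPrime.OfTakahashi.FreyIsogenyRadiusSubpoly :=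
  Summit.ABC.ABC.Theorems.DefiniteRTControlPrime.OfTakahashi.freyIsogenyRadiusSubpoly

example {a b : ℤ} (hab : IsCoprime a b) (h0 : a * b * (a + b) ≠ 0) {q : ℕ} (hq : q.Prime)
    (hq2 : q ≠ 2) (hqN : q ∣ (freyCurve a b).conductorNorm ℤ) {W' : WeierstrassCurve ℚ}
    [W'.IsElliptic] {B : ℕ} (φ : Isogeny (freyCurve a b) W') (hφ : φ.degree ≤ B) :
    (W'.minimalDiscriminantNorm ℤ).factorization q ≤
      B * ((freyCurve a b).minimalDiscriminantNorm ℤ).factorization q :=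
  Summit.ABC.ABC.Theorems.DefiniteRTControlPrime.OfTakahashi.factorization_le_mul_of_isogeny
    hab h0 hq hq2 hqN φ hφ

/-! ## §1 · gen-15 RESHAPE T3: the fact's OTHER consumers in route DefiniteXi, Mazur-free (typed)

Each `def` below is the STATEMENT a prover should land (one cycle each); the sibling Templates file
certifies BY NAME the `163`-template theorem whose proof is copied with two `have`s swapped
(`h163 …` ↦ the radius isogeny of `freyIsogenyRadiusSubpoly`, `stub_valTransport h68 …` ↦
`factorization_le_mul_of_isogeny`). -/

/-- **H5** (S) — Mazur-free pointwise converse of the crux: for every datum `D` of the Frey model,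
`ξ(N/q, q)(a(E_{a,b})) ≤ R_ε N^ε · deg D · v_q(Δ_min E_{a,b})` (the template has `163` for
`R_ε N^ε`).  Proof template: `brandtXi_le_deg_mul_factorization` with `hval` from the radius. -/
def BrandtXiLeDegMulFactorizationSubpoly : Prop :=
  ∀ ε : ℝ, 0 < ε → ∃ R : ℝ, ∀ a b : ℤ, IsCoprime a b → a * b * (a + b) ≠ 0 →
    ∀ (N : ℕ) [NeZero N], (freyCurve a b).conductorNorm ℤ = N → ∀ q : ℕ, q.Prime → q ≠ 2 → q ∣ N →
      ∀ D : ModularParametrizationData (freyCurve a b) N,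
        (brandtXi (N / q) q (fun n => (freyCurve a b).LFunction n) : ℝ) ≤
          R * (N : ℝ) ^ ε * (D.deg : ℝ) *
            ((((freyCurve a b).minimalDiscriminantNorm ℤ).factorization q : ℕ) : ℝ)

/-- H5 as the prover's target: from Takahashi 2.3 (coprime form) alone. -/
def H5 : Prop := takahashi2001_thm_2_3_of_coprime → BrandtXiLeDegMulFactorizationSubpoly

/-- **H6** (M⁻) — SteinbergCore's prime-type `ξ`-versus-degree comparison from Takahashi 2.3 and
`FreyModularity` ONLY (template `xiDegreeComparison_prime_of_facts` takes `h163`, `h68` as well):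
`cps ξ(N/q; q) ≤ C_ε N^ε · cps (deg D) · T³`.  In the template's chain
`cps ξ ≤ cps(δ₀)·m⋆·i ≤ cps(deg D)·(4·163)·(163 T)` replace `m_E ≤ 4·163` by `m_E ≤ 4·deg φ₀`
(`OfTakahashi.modularDegree_le_degree_mul` / `exists_isogeny_degree_mul_modularDegree_eq`) and
`i ≤ 163 T` by `i ≤ deg φ⋆ · T` (`factorization_le_mul_of_isogeny`), both `deg φ ≤ R_{ε/3} N^{ε/3}`. -/
def XiDegreeComparisonPrimeOfTakahashi : Prop :=
  takahashi2001_thm_2_3_of_coprime →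
  Summit.ABC.ABC.Theses.DefiniteXi.FreyModularity →
    ∀ ε : ℝ, 0 < ε → ∃ C : ℝ, ∀ a b : ℤ, IsCoprime a b → a * b * (a + b) ≠ 0 → ∀ (N : ℕ) [NeZero N],
      (freyCurve a b).conductorNorm ℤ = N →
      ∀ q : ℕ, q.Prime → q ≠ 2 → q ∣ N →
      brandtXi (N / q) q (fun n => (freyCurve a b).LFunction n) ≠ 0 →
      ∃ D : ModularParametrizationData (freyCurve a b) N,
        (∀ D' : ModularParametrizationData (freyCurve a b) N, D.deg ≤ D'.deg) ∧
        ((brandtXi (N / q) q (fun n => (freyCurve a b).LFunction n) /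
            (ordProj[2] (brandtXi (N / q) q (fun n => (freyCurve a b).LFunction n)) *
              ordProj[3] (brandtXi (N / q) q (fun n => (freyCurve a b).LFunction n))) : ℕ) : ℝ) ≤
          C * (N : ℝ) ^ ε * ((D.deg / (ordProj[2] D.deg * ordProj[3] D.deg) : ℕ) : ℝ) *
            ((∏ p ∈ N.primeFactors,
                ((freyCurve a b).minimalDiscriminantNorm ℤ).factorization p : ℕ) : ℝ) ^ 3

/-- **H7** (S, after H5) — `FreyDegreeBound ⟹` the prime rung of `XiStrongBound`, Mazur-free
(template `primeXiStrongBound_of_freyDegreeBound hT h68 hX`; its only use of `h68` is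
`brandtXi_mul_factorization_le` = H5 × `v_q`, and the target has `N^{2+ε}` slack). -/
def PrimeXiStrongBoundOfFreyDegreeBoundOfTakahashi : Prop :=
  takahashi2001_thm_2_3_of_coprime → Summit.ABC.ABC.Theses.DefiniteXi.FreyDegreeBound →
    ∀ ε : ℝ, 0 < ε → ∃ C : ℝ, ∀ a b : ℤ, IsCoprime a b → a * b * (a + b) ≠ 0 →
      ∀ (N : ℕ) [NeZero N], (freyCurve a b).conductorNorm ℤ = N → ∀ q : ℕ, q.Prime → q ≠ 2 → q ∣ N →
        (brandtXi (N / q) q (fun n => (freyCurve a b).LFunction n) : ℝ) *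
          ((((freyCurve a b).minimalDiscriminantNorm ℤ).factorization q : ℕ) : ℝ) ≤
            C * (N : ℝ) ^ (2 + ε)

end Summit.ABC.ABC.Cruxes.DefiniteRTControlPrime.StubIdeasK2G15
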